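/-
Copyright (c) 2026 the pub-hodgecm-mathlib formalisation cell (harness21).  Prover seat hodgecm-mathlib-K2E3-p03 (g8), HCML Track B «K2-LIT» ∕ h413
(`stmt-HodgeConjecture-24833`), leaf (nsc-S-A′), bricks C1′∕C1″ (NAA ∕ NYA): a `GL₂`-SUBREPRESENTATION OF `r_Q ω` WITH ZERO `U₂`-COINVARIANTS IS ZERO (`ω` irreducible, cell hypothesis).
Single-level form of K2E3-p17 (g9)'s (K-c) `peel_kernel_eq_bot` (proof adapted from their draft, same ★ inputs).  2026-09-04.
-/
import Summits.HodgeConjecture.HodgeConjecture.Theorems.K2E3JacquetSubquotientNoCuspidalBool     -- ★ (K-b) (K2E3-p17 g9): `eq_zero_of_stagesMap_cyclic_eq_zero`; brings ★ BorelStages `ker_stagesMap_eq`, ★ H0 `isSmooth_normalizedJacquetGL`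
import Summits.HodgeConjecture.HodgeConjecture.Theorems.K2E3GL2JacquetRelabel                    -- ★ (K2E3-p14): `coinvariantsKer_restrictUnipotentGL_eq`, `unipotentRadicalGL_id_eq_lastBlockLabel_two`
import Literature.NumberTheory.Automorphic.MatrixCoefficientsSupercuspidalAdmissibleProofs         -- ★ Schur: `IsIrreducible.exists_eq_smul_id_of_rank_le_aleph0`, `IsSmooth.rank_le_aleph0`
import Literature.NumberTheory.Automorphic.PAdicRepsSupercuspidalProofs                            -- ★ `sigmaCompactSpace_generalLinearGroup`
import Literature.RepresentationTheory.FiniteGroups.EquivOfCharacter                               -- ★ `Subrepresentation.subtypeIntertwiningMap`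
import HarnessLib

/-!
# Crux `H413` — leaf (nsc-S-A′), bricks C1′∕C1″: a `GL₂`-stable `K ≤ r_Q ω` with `r_{U₂}(K) = 0` vanishes

Cell `hodgecm-mathlib`, Track B; THEOREMS ONLY; count-neutral helper (`--supports stmt-HodgeConjecture-24833 --as helper`).  `Q = P_{(2,1)}` labelled
`![false,false,true]`, `W = (r_Q ω) ∘ ι_e` the `GL₂`-part of the normalised Jacquet module (★ BRIDGE currency), `p : r_Q ω ↠ r_B ω` the ★ stages map.
* **`eq_bot_of_subsingleton_coinvariants`** — for `ω` IRREDUCIBLE smooth, presented as a subquotient of a smooth `I` carrying the cell hypothesis at `c = ![0,0,1]`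
  (`ι₁` injective, `π₁` surjective), every `GL₂`-subrepresentation `K ≤ W` with `r_{U₂}(K) = 0` is `⊥`: its vectors die under `p` (★ `jacquetGLMap_injective` at `n = 2`,
  ★ `ker_stagesMap_eq`); by SCHUR on the centre of `GL₃(F)` (★ `IsIrreducible.exists_eq_smul_id_of_rank_le_aleph0`; `diag(m) = (t·1₃)·diag(t⁻¹ m)` with `(t⁻¹m)|_{GL₁} = 1`)
  `K` is stable under the WHOLE Levi, so ★ (K-b)'s cyclic «no cuspidal vectors» `eq_zero_of_stagesMap_cyclic_eq_zero` kills each vector.  This is the ONE-LEVEL form of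
  K2E3-p17 (g9)'s (K-c) `peel_kernel_eq_bot` (there: `K₂ ≤ K₁ ≤ W`); proof = theirs with `K₂ ≤ K₁` collapsed to `K`.
Consumers: NAA `K2E3GL3NoWeightAAlone*` (this seat: one ★ S2 peel of `W` has such a kernel), hence NYA by ★ (T) transport.
[BernsteinZelevinsky1977, Prop. 1.9, §2.3–2.4, Thm. 2.5, Thm. 2.9]; [BernsteinZelevinsky1976, 2.11].

HONEST LABEL: HC_CM is proved only modulo the 7 printed citations (2 remaining named inputs: hLiu418 = stmt-HodgeConjecture-24832, h413 =
stmt-HodgeConjecture-24833) until rung 0 closes; count-neutral helper.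

## References
* [BernsteinZelevinsky1977] I. N. Bernstein, A. V. Zelevinsky, *Induced representations of reductive p-adic groups I*, Ann. Sci. ÉNS 10 (1977), Prop. 1.9, §2.3–2.4, Thm. 2.5, Thm. 2.9.
* [BernsteinZelevinsky1976] I. N. Bernstein, A. V. Zelevinsky, *Representations of the group GL(n,F) where F is a non-archimedean local field*, Russ. Math. Surveys 31:3 (1976), 2.11.
-/

set_option autoImplicit false
-- the mandated namespace repeats `HodgeConjecture.HodgeConjecture`, as in every `Theorems/*.lean` of this sub-problem
set_option linter.dupNamespace false

noncomputable section

open Module Representation Function Literature.NumberTheory.Automorphic Literature.NumberTheory.Automorphic.Zelevinsky1980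
open Literature.NumberTheory.GaloisRepresentations.IsNonarchimedeanLocalField Literature.RepresentationTheory.FiniteGroups Literature.RepresentationTheory.Semisimple
open scoped MatrixGroups NNReal
open Summit.HodgeConjecture.HodgeConjecture.Cruxes.H413.K2E3JacquetSubquotientNoCuspidalBool (eq_zero_of_stagesMap_cyclic_eq_zero)
open Summit.HodgeConjecture.HodgeConjecture.Cruxes.H413.K2E3GL3JacquetInStagesBorel (ker_stagesMap_eq)
open Summit.HodgeConjecture.HodgeConjecture.Cruxes.H413.K2E3GL3ExponentRules (isSmooth_normalizedJacquetGL)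
open Summit.HodgeConjecture.HodgeConjecture.Cruxes.H413

namespace Summit.HodgeConjecture.HodgeConjecture.Cruxes.H413.K2E3GL3PeelKernelZero

variable {F : Type} [Field F] [ValuativeRel F] [TopologicalSpace F] [IsNonarchimedeanLocalField F]

set_option maxHeartbeats 6400000 in  -- cumulative budget of one long bookkeeping proof over large Jacquet-module terms (as (K-c))
/-- **A `GL₂`-SUBREPRESENTATION OF `r_Q ω` WITHOUT `U₂`-COINVARIANTS IS ZERO.**  `ω` irreducible smooth on `GL₃(F)`, a subquotient (`ι₁` injective, `π₁` surjective) of a smooth `I`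
carrying the cell hypothesis at `c = ![0,0,1]`; `K ≤ W = (r_Q ω) ∘ ι_e` with `r_{U₂}(K) = 0`.  Then `K = ⊥`.  (One-level form of K2E3-p17's `peel_kernel_eq_bot`.)
[cite: BernsteinZelevinsky1977, Prop. 1.9, Thm. 2.5, §2.4, Thm. 2.9] [cite: BernsteinZelevinsky1976, 2.11] -/
theorem eq_bot_of_subsingleton_coinvariants
    (e : Fin 2 ≃ {i : Fin 3 // (![false, false, true] : Fin 3 → Bool) i = false})
    (he : ∀ j : Fin 2, ((e j : {i : Fin 3 // (![false, false, true] : Fin 3 → Bool) i = false}) : Fin 3) = Fin.castSucc j)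
    {XI X₁ X : Type} [AddCommGroup XI] [Module ℂ XI] [AddCommGroup X₁] [Module ℂ X₁] [AddCommGroup X] [Module ℂ X]
    (I : Representation ℂ (GL (Fin 3) F) XI) (ω₁ : Representation ℂ (GL (Fin 3) F) X₁) (ω : Representation ℂ (GL (Fin 3) F) X) (hI : I.IsSmooth)
    (hcell : ∀ (W : Type) [AddCommGroup W] [Module ℂ W] (σ : Representation ℂ (Π a, GL {i // (![0, 0, 1] : Fin 3 → Fin 2) i = a} F) W),
      σ.IsIrreducible → σ.IsSmooth → σ.IsSupercuspidal → ∀ (N : Subrepresentation (jacquetGL F (![0, 0, 1] : Fin 3 → Fin 2) I)) (q : N.toRepresentation.IntertwiningMap σ), q = 0)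
    (ι₁ : ω₁.IntertwiningMap I) (hι₁ : Function.Injective ι₁) (π₁ : ω₁.IntertwiningMap ω) (hπ₁ : Function.Surjective π₁) [ω.IsIrreducible] (hω : ω.IsSmooth)
    (K : Subrepresentation ((normalizedJacquetGL F (![false, false, true] : Fin 3 → Bool) ω).comp ((MonoidHom.mulSingle (fun a : Bool => GL {i : Fin 3 // (![false, false, true] : Fin 3 → Bool) i = a} F) false).comp (reindexGL e).toMonoidHom) : Representation ℂ (GL (Fin 2) F) (restrictUnipotentGL F (![false, false, true] : Fin 3 → Bool) ω).Coinvariants))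
    (hK : Subsingleton (restrictUnipotentGL F (lastBlockLabel 2) K.toRepresentation).Coinvariants) :
    K = ⊥ := by
  haveI : IsTopologicalRing F := inferInstance
  -- `W` is smooth
  have hcont : Continuous (((MonoidHom.mulSingle (fun a : Bool => GL {i : Fin 3 // (![false, false, true] : Fin 3 → Bool) i = a} F) false).comp (reindexGL e).toMonoidHom) : GL (Fin 2) F → (Π a : Bool, GL {i : Fin 3 // (![false, false, true] : Fin 3 → Bool) i = a} F)) := (_root_.continuous_mulSingle false).comp (continuous_reindexGL e)
  have hnsm : (normalizedJacquetGL F (![false, false, true] : Fin 3 → Bool) ω).IsSmooth := isSmooth_normalizedJacquetGL (![false, false, true] : Fin 3 → Bool) hω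
  have hWsm : Representation.IsSmooth ((normalizedJacquetGL F (![false, false, true] : Fin 3 → Bool) ω).comp ((MonoidHom.mulSingle (fun a : Bool => GL {i : Fin 3 // (![false, false, true] : Fin 3 → Bool) i = a} F) false).comp (reindexGL e).toMonoidHom) : Representation ℂ (GL (Fin 2) F) (restrictUnipotentGL F (![false, false, true] : Fin 3 → Bool) ω).Coinvariants) := IsSmooth.comp_of_continuous _ _ hcont hnsm
  -- (B) every vector of `K` dies under the stages map `p`
  have hpK : ∀ k : ↥K.toSubmodule, (Representation.Coinvariants.lift (restrictUnipotentGL F (![false, false, true] : Fin 3 → Bool) ω) (Representation.Coinvariants.mk (restrictUnipotentGL F (id : Fin 3 → Fin 3) ω)) (K2E3GL3JacquetInStagesBorel.mk_comp_restrictUnipotentGL_twoOne_eq ω)) ((k : (restrictUnipotentGL F (![false, false, true] : Fin 3 → Bool) ω).Coinvariants)) = 0 := by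
    intro k
    obtain ⟨f, hf⟩ : ∃ f : K.toRepresentation.IntertwiningMap ((normalizedJacquetGL F (![false, false, true] : Fin 3 → Bool) ω).comp ((MonoidHom.mulSingle (fun a : Bool => GL {i : Fin 3 // (![false, false, true] : Fin 3 → Bool) i = a} F) false).comp (reindexGL e).toMonoidHom) : Representation ℂ (GL (Fin 2) F) (restrictUnipotentGL F (![false, false, true] : Fin 3 → Bool) ω).Coinvariants), ∀ x, f x = ((x : ↥K.toSubmodule) : (restrictUnipotentGL F (![false, false, true] : Fin 3 → Bool) ω).Coinvariants) :=
      ⟨Subrepresentation.subtypeIntertwiningMap K, fun x => rfl⟩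
    have hfinj : Function.Injective f := fun a b hab => by
      rw [hf, hf] at hab
      exact Subtype.ext hab
    have hinj := jacquetGLMap_injective (F := F) (c := (id : Fin 2 → Fin 2)) monotone_id hWsm f hfinj
    -- `[k] = 0` in `r_{U₂}(K)` (the `lastBlockLabel 2` and `id` labellings give one kernel)
    have hk0 : (k : ↥K.toSubmodule) ∈ Coinvariants.ker (restrictUnipotentGL F (id : Fin 2 → Fin 2) K.toRepresentation) := by
      rw [K2E3GL2JacquetRelabel.coinvariantsKer_restrictUnipotentGL_eq (id : Fin 2 → Fin 2) (lastBlockLabel 2) K2E3GL2JacquetRelabel.unipotentRadicalGL_id_eq_lastBlockLabel_two K.toRepresentation]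
      exact (Coinvariants.mk_eq_zero _).1 (Subsingleton.elim _ _)
    have h1 : jacquetGLMap F (id : Fin 2 → Fin 2) f (Coinvariants.mk (restrictUnipotentGL F (id : Fin 2 → Fin 2) K.toRepresentation) k) =
        Coinvariants.mk (restrictUnipotentGL F (id : Fin 2 → Fin 2) ((normalizedJacquetGL F (![false, false, true] : Fin 3 → Bool) ω).comp ((MonoidHom.mulSingle (fun a : Bool => GL {i : Fin 3 // (![false, false, true] : Fin 3 → Bool) i = a} F) false).comp (reindexGL e).toMonoidHom) : Representation ℂ (GL (Fin 2) F) (restrictUnipotentGL F (![false, false, true] : Fin 3 → Bool) ω).Coinvariants)) (f k) := jacquetGLMap_mk f k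
    have h2 : Coinvariants.mk (restrictUnipotentGL F (id : Fin 2 → Fin 2) ((normalizedJacquetGL F (![false, false, true] : Fin 3 → Bool) ω).comp ((MonoidHom.mulSingle (fun a : Bool => GL {i : Fin 3 // (![false, false, true] : Fin 3 → Bool) i = a} F) false).comp (reindexGL e).toMonoidHom) : Representation ℂ (GL (Fin 2) F) (restrictUnipotentGL F (![false, false, true] : Fin 3 → Bool) ω).Coinvariants)) (f k) = 0 := by
      rw [← h1, (Coinvariants.mk_eq_zero _).2 hk0, map_zero]
    have h3 : f k ∈ Coinvariants.ker (restrictUnipotentGL F (id : Fin 2 → Fin 2) ((normalizedJacquetGL F (![false, false, true] : Fin 3 → Bool) ω).comp ((MonoidHom.mulSingle (fun a : Bool => GL {i : Fin 3 // (![false, false, true] : Fin 3 → Bool) i = a} F) false).comp (reindexGL e).toMonoidHom) : Representation ℂ (GL (Fin 2) F) (restrictUnipotentGL F (![false, false, true] : Fin 3 → Bool) ω).Coinvariants)) := (Coinvariants.mk_eq_zero _).1 h2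
    rw [← ker_stagesMap_eq e he ω, LinearMap.mem_ker, hf] at h3
    exact h3
  -- (C) Schur: the centre of `GL₃(F)` acts on `ω` by scalars
  haveI : SigmaCompactSpace (GL (Fin 3) F) := sigmaCompactSpace_generalLinearGroup F 3
  have hG : ∀ U : Subgroup (GL (Fin 3) F), IsOpen (U : Set (GL (Fin 3) F)) → Countable (GL (Fin 3) F ⧸ U) :=
    fun U hU => countable_quotient_of_isOpen_of_sigmaCompactSpace U hU
  have hZ : ∀ t : Fˣ, ∃ c : ℂ, ω (Matrix.GeneralLinearGroup.scalar (Fin 3) t) = c • (LinearMap.id : X →ₗ[ℂ] X) :=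
    fun t => IsIrreducible.exists_eq_smul_id_of_rank_le_aleph0 (hω.rank_le_aleph0 hG) _ fun h => by
      rw [← Module.End.mul_eq_comp, ← Module.End.mul_eq_comp, ← map_mul, ← map_mul, Matrix.GeneralLinearGroup.scalar_commute]
  -- the block-scalar Levi element `(t·1₂, t·1₁)` has matrix `t·1₃`
  have hscal : ∀ t : Fˣ, blockDiagonalGL F (![false, false, true] : Fin 3 → Bool) (fun a => Matrix.GeneralLinearGroup.scalar _ t) = Matrix.GeneralLinearGroup.scalar (Fin 3) t := by
    intro t
    apply Units.ext
    ext i j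
    simp only [blockDiagonalGL_apply_coe_dite, Matrix.GeneralLinearGroup.coe_scalar, Matrix.scalar_apply, Matrix.diagonal_apply]
    by_cases hij : i = j
    · subst hij
      simp
    · rw [if_neg hij]
      split_ifs with h1 h2
      · exact absurd (congrArg Subtype.val h2) hij
      · rfl
      · rfl
  -- the `GL₁`-block is `1 × 1`
  have hsub : ∀ i : {i : Fin 3 // (![false, false, true] : Fin 3 → Bool) i = true}, i = ⟨2, rfl⟩ := fun i =>
    Subtype.ext (by have hi := i.2; revert hi; generalize (i : Fin 3) = k; intro hk; fin_cases k <;> simp_all)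
  have htrue : ∀ d : GL {i : Fin 3 // (![false, false, true] : Fin 3 → Bool) i = true} F, d = Matrix.GeneralLinearGroup.scalar _ (Matrix.GeneralLinearGroup.det d) := by
    intro d
    apply Units.ext
    ext i j
    obtain rfl := hsub i
    obtain rfl := hsub j
    haveI : Subsingleton {i : Fin 3 // (![false, false, true] : Fin 3 → Bool) i = true} := ⟨fun a b => (hsub a).trans (hsub b).symm⟩
    rw [Matrix.GeneralLinearGroup.coe_scalar, Matrix.scalar_apply, Matrix.diagonal_apply_eq, Matrix.GeneralLinearGroup.val_det_apply,
      Matrix.det_eq_elem_of_subsingleton _ (⟨2, rfl⟩ : {i : Fin 3 // (![false, false, true] : Fin 3 → Bool) i = true})]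
  -- (D) `K` is stable under the whole Levi
  have hSW : ∀ (g : GL (Fin 2) F) (x : (restrictUnipotentGL F (![false, false, true] : Fin 3 → Bool) ω).Coinvariants), x ∈ K.toSubmodule → ((normalizedJacquetGL F (![false, false, true] : Fin 3 → Bool) ω).comp ((MonoidHom.mulSingle (fun a : Bool => GL {i : Fin 3 // (![false, false, true] : Fin 3 → Bool) i = a} F) false).comp (reindexGL e).toMonoidHom) : Representation ℂ (GL (Fin 2) F) (restrictUnipotentGL F (![false, false, true] : Fin 3 → Bool) ω).Coinvariants) g x ∈ K.toSubmodule :=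
    fun g _ hx => K.apply_mem_toSubmodule g hx
  have hSfalse : ∀ (g : GL {i : Fin 3 // (![false, false, true] : Fin 3 → Bool) i = false} F) (x : (restrictUnipotentGL F (![false, false, true] : Fin 3 → Bool) ω).Coinvariants), x ∈ K.toSubmodule →
      jacquetGL F (![false, false, true] : Fin 3 → Bool) ω (Pi.mulSingle (M := (fun a : Bool => GL {i : Fin 3 // (![false, false, true] : Fin 3 → Bool) i = a} F)) false g) x ∈ K.toSubmodule := by
    intro g x hx
    have hW := hSW ((reindexGL e).symm g) x hx
    have hrew : ((normalizedJacquetGL F (![false, false, true] : Fin 3 → Bool) ω).comp ((MonoidHom.mulSingle (fun a : Bool => GL {i : Fin 3 // (![false, false, true] : Fin 3 → Bool) i = a} F) false).comp (reindexGL e).toMonoidHom) : Representation ℂ (GL (Fin 2) F) (restrictUnipotentGL F (![false, false, true] : Fin 3 → Bool) ω).Coinvariants) ((reindexGL e).symm g) x =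
        (((((rootDeltaChar (standardParabolicGL F (![false, false, true] : Fin 3 → Bool)))⁻¹).comp (leviEmbeddingP F (![false, false, true] : Fin 3 → Bool))) (Pi.mulSingle (M := (fun a : Bool => GL {i : Fin 3 // (![false, false, true] : Fin 3 → Bool) i = a} F)) false g) : ℂˣ) : ℂ) •
          jacquetGL F (![false, false, true] : Fin 3 → Bool) ω (Pi.mulSingle (M := (fun a : Bool => GL {i : Fin 3 // (![false, false, true] : Fin 3 → Bool) i = a} F)) false g) x := by
      change (normalizedJacquetGL F (![false, false, true] : Fin 3 → Bool) ω) (((MonoidHom.mulSingle (fun a : Bool => GL {i : Fin 3 // (![false, false, true] : Fin 3 → Bool) i = a} F) false).comp (reindexGL e).toMonoidHom) ((reindexGL e).symm g)) x = _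
      rw [MonoidHom.comp_apply, MulEquiv.coe_toMonoidHom, MulEquiv.apply_symm_apply, MonoidHom.mulSingle_apply]
      rfl
    rw [hrew] at hW
    have hu : IsUnit (((((rootDeltaChar (standardParabolicGL F (![false, false, true] : Fin 3 → Bool)))⁻¹).comp (leviEmbeddingP F (![false, false, true] : Fin 3 → Bool))) (Pi.mulSingle (M := (fun a : Bool => GL {i : Fin 3 // (![false, false, true] : Fin 3 → Bool) i = a} F)) false g) : ℂˣ) : ℂ) := Units.isUnit _
    exact (Submodule.smul_mem_iff_of_isUnit _ hu).1 hW
  have hScentre : ∀ (t : Fˣ) (x : (restrictUnipotentGL F (![false, false, true] : Fin 3 → Bool) ω).Coinvariants), x ∈ K.toSubmodule →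
      jacquetGL F (![false, false, true] : Fin 3 → Bool) ω (fun a => Matrix.GeneralLinearGroup.scalar _ t) x ∈ K.toSubmodule := by
    intro t x hx
    obtain ⟨c, hc⟩ := hZ t
    obtain ⟨v, rfl⟩ := Coinvariants.mk_surjective _ x
    rw [jacquetGL_mk, hscal, hc, LinearMap.smul_apply, LinearMap.id_apply, map_smul]
    exact Submodule.smul_mem _ c hx
  have hSall : ∀ (m : (Π a : Bool, GL {i : Fin 3 // (![false, false, true] : Fin 3 → Bool) i = a} F)) (x : (restrictUnipotentGL F (![false, false, true] : Fin 3 → Bool) ω).Coinvariants), x ∈ K.toSubmodule →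
      jacquetGL F (![false, false, true] : Fin 3 → Bool) ω m x ∈ K.toSubmodule := by
    intro m x hx
    -- `m = (t·1) · m′` with `m′|_{GL₁} = 1`
    have hm : m = (fun a => Matrix.GeneralLinearGroup.scalar _ (Matrix.GeneralLinearGroup.det (m true))) *
        Pi.mulSingle (M := (fun a : Bool => GL {i : Fin 3 // (![false, false, true] : Fin 3 → Bool) i = a} F)) false
          ((Matrix.GeneralLinearGroup.scalar _ (Matrix.GeneralLinearGroup.det (m true)))⁻¹ * m false) := by
      funext a
      cases a
      · rw [Pi.mul_apply, Pi.mulSingle_eq_same, mul_inv_cancel_left]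
      · rw [Pi.mul_apply, Pi.mulSingle_eq_of_ne (by decide), mul_one]
        exact htrue (m true)
    rw [hm, map_mul, Module.End.mul_apply]
    exact hScentre _ _ (hSfalse _ _ hx)
  obtain ⟨W₂, hW₂⟩ : ∃ W₂ : Subrepresentation (jacquetGL F (![false, false, true] : Fin 3 → Bool) ω), W₂.toSubmodule = K.toSubmodule :=
    ⟨⟨_, fun m x hx => hSall m x hx⟩, rfl⟩
  have hW₂p : ∀ y : (restrictUnipotentGL F (![false, false, true] : Fin 3 → Bool) ω).Coinvariants, y ∈ W₂ → (Representation.Coinvariants.lift (restrictUnipotentGL F (![false, false, true] : Fin 3 → Bool) ω) (Representation.Coinvariants.mk (restrictUnipotentGL F (id : Fin 3 → Fin 3) ω)) (K2E3GL3JacquetInStagesBorel.mk_comp_restrictUnipotentGL_twoOne_eq ω)) y = 0 := by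
    intro y hy
    have hy' : y ∈ W₂.toSubmodule := hy
    rw [hW₂] at hy'
    exact hpK ⟨y, hy'⟩
  -- (E) (K-b), vector by vector
  apply Subrepresentation.toSubmodule_injective
  show K.toSubmodule = ⊥
  refine (Submodule.eq_bot_iff _).2 fun k hk => ?_
  have hxW₂ : k ∈ W₂ := by
    show k ∈ W₂.toSubmodule
    rw [hW₂]
    exact hk
  exact eq_zero_of_stagesMap_cyclic_eq_zero e he I ω₁ ω hI hcell ι₁ hι₁ π₁ hπ₁ hω k (fun y hy => by
    apply hW₂p
    rw [Subrepresentation.mem_ofSubmodule'_iff] at hy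
    exact Subrepresentation.mem_asSubmodule_iff.1
      ((Submodule.span_le.2 (Set.singleton_subset_iff.2 (Subrepresentation.mem_asSubmodule_iff.2 hxW₂))) hy))

end Summit.HodgeConjecture.HodgeConjecture.Cruxes.H413.K2E3GL3PeelKernelZero

end
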